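import Literature.Probability.LatticeModels.PlaneRotatorTwistInequality
import Mathlib.Analysis.SpecialFunctions.Complex.CircleAddChar
import HarnessLib

/-!
# Flux periodicity of the twisted plane rotator on `(ℤ/Lℤ)²` and the uniform Bloch-wall bound
# `sup_t [log Z_L(0) − log Z_L(t)] ≤ (π²/2)·K·E_L(K)`

Topic `Literature/Probability/LatticeModels`. Companion of `PlaneRotatorHelicityModulus.lean` (the twisted
torus `Z_L(t) = ∫ exp(K ∑_{(z,i)} cos(θ_{z+eᵢ} − θ_z + t·[i = 0])) dθ`, `twistPartitionFn` with the profile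
`torusTwistProfile`) and `PlaneRotatorTwistInequality.lean` (Fröhlich–Pfister 1983 Lemma 3.1 two-sided:
`0 ≤ log Z_L(0) − log Z_L(t) ≤ (t²/2)·∑_b K s_b² ⟨cos ∇θ_b⟩`, `log_twistPartitionFn_zero_sub_mem_Icc`).

* §1 **Flux periodicity** (`torusXY_twistPartitionFn_add_fluxQuantum`): `Z_L(t + 2πk/L) = Z_L(t)` for every
  `k ∈ ℤ`. A uniform twist `t` per `e₁`-bond is a total twist `Θ = L·t` around the `e₁`-cycle, and a total
  twist of `k` flux quanta `2πk` is removed by the gauge transformation `θ_z ↦ θ_z · e^{2πikz₁/L}` (well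
  defined on `ℤ/Lℤ` through the additive character `ZMod.toCircle`; `torusGauge_bond`), under which each `e₁`-bond
  character picks up `e^{2πik/L}` (`torusXY_bondChar_mul_torusGauge`), the twisted Hamiltonian shifts
  `H_t(θ·g) = H_{t+2πk/L}(θ)` (`torusXY_twistHamiltonian_mul_torusGauge`), and the Haar measure is invariant.
  This is the statement «twisted boundary conditions are defined modulo `2π`» of Fisher–Barber–Jasnow's
  twisted ensemble (Phys. Rev. A 8 (1973) 1111, §II), as an identity of the finite-volume partition function.
* §2 **The uniform Bloch-wall bound** (`torusXY_log_twist_le_uniform`): for `K ≥ 0` and EVERY twist `t`,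
  `log Z_L(0) − log Z_L(t) ≤ (π²/2)·K·E_L(K)` — uniformly in the volume AND in the twist: by §1 the twist
  free energy lives on one flux period `|t + 2πk/L| ≤ π/L` (`exists_fluxQuantum_reduction`), where the
  spin-wave parabola of the sibling file (`L²·(Kt²/2)·E_L`, all `2L²` bond energies equal to `E_L(K)`,
  `torusXYBondEnergy_eq`) is at most `π²KE_L/2`; with the equipartition ceiling `E_L ≤ 8K/(1+8K)`
  (`torusXYBondEnergy_le`): `≤ 4π²K²/(1 + 8K)` for every `L ≥ 3`, `K > 0`
  (`torusXY_log_twist_le_uniform_energyCeiling`). In Fröhlich–Pfister's words (Comm. Math. Phys. 89 (1983)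
  303, Lemma 3.1: `0 ≤ −π(L,T) ≤ O(L^{d−2} log L)`): the free energy of a Bloch wall of ANY angle across the
  two-dimensional torus is bounded, `τ = 0` at every temperature — here with an explicit constant and, for
  the uniform twist profile, without the logarithm.

Reading (cell `pub/hubbard-tc`, MO-S3, crux №2 classical side): the flux period `2π/L` is the exact symmetry
every finite-volume stiffness / winding statement of the Υ_L-typed crux must respect; the uniform bound says
the finite-volume twist free energy per site is `O(L⁻²)` uniformly in the twist.

## What this is not

A classical comparison-model file (plane rotator); nothing about electrons; no number of record moves;
not `Υ_∞ > 0` (Fröhlich–Spencer) nor its jump; no thermodynamic limit.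

## References

* M. E. Fisher, M. N. Barber, D. Jasnow, Phys. Rev. A 8 (1973) 1111, §II (twisted ensemble; twists
  modulo `2π`, gauge equivalence with the uniform gradient). [FisherBarberJasnow1973]
* J. Fröhlich, C.-E. Pfister, Comm. Math. Phys. 89 (1983) 303–327, Lemma 3.1 p. 307–308
  (held: `paper:doi-10-1007-bf01214657` p0005–p0006). [FrohlichPfister1983]
* M. Aizenman, B. Simon, Comm. Math. Phys. 77 (1980) 137, eq. (2.4) (energy ceiling via the tree).
  [AizenmanSimon1980LocalWard]

Tree: `BondSystem.twistPartitionFn/twistWeight/twistHamiltonian/bondChar`,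
`BondSystem.log_twistPartitionFn_zero_sub_mem_Icc` (p1, `PlaneRotatorTwistInequality.lean`), `torusXY`,
`torusTwistProfile`, `torusXYBondEnergy(_eq/_le)`, `torusXY_expectJ_reChar_bondChar`,
`integral_torusHaar_mul_right`, Mathlib `ZMod.toCircle`.
-/

noncomputable section

open MeasureTheory Finset Filter
open scoped BigOperators Real

namespace Literature.Probability.LatticeModels

/-! ## §1 Flux periodicity: a twist by one flux quantum is a gauge transformation -/

section Gauge

variable {L : ℕ} [NeZero L]

/-- The **gauge function** `g_z = e^{2πi k z₁/L}` on `(ℤ/Lℤ)²` (`k ∈ ℤ` flux quanta; well defined on `ℤ/Lℤ`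
through the additive character `ZMod.toCircle`, written inline as `fun z => toCircle (z 0) ^ k`) advances
by `(toCircle 1)^k = e^{2πik/L}` along an `e₁`-bond and is constant along an `e₂`-bond. [cite: FisherBarberJasnow1973, §II eqs. (2.3)–(2.5) (gauge equivalence of twisted boundary conditions and the uniform phase gradient)] -/
theorem torusGauge_bond (k : ℤ) (z : TorusSite 2 L) (i : Fin 2) :
    (ZMod.toCircle (z 0) ^ k)⁻¹ * ZMod.toCircle ((z + Pi.single i 1 : TorusSite 2 L) 0) ^ k =
      if i = 0 then ZMod.toCircle (1 : ZMod L) ^ k else 1 := by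
  split_ifs with hi
  · subst hi
    rw [Pi.add_apply, Pi.single_eq_same, AddChar.map_add_eq_mul, mul_zpow, ← mul_assoc,
      inv_mul_cancel, one_mul]
  · rw [Pi.add_apply, Pi.single_eq_of_ne' hi, add_zero]
    exact inv_mul_cancel _

omit [NeZero L] in
/-- `cos(α) Re χ − sin(α) Im χ = Re(e^{iα} χ)`: the twisted term of one bond through its phase. [cite: GarbanSpencer2022, (1.3) (bond phases)] -/
theorem cos_mul_reChar_sub_sin_mul_imChar {V : Type*} (α : ℝ) (χ : (V → Circle) →ₜ* Circle)
    (θ : V → Circle) :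
    Real.cos α * reChar χ θ - Real.sin α * imChar χ θ = (((Circle.exp α * χ θ : Circle) : ℂ)).re := by
  rw [reChar, imChar, Circle.coe_mul, Circle.coe_exp, Complex.mul_re, Complex.exp_ofReal_mul_I_re,
    Complex.exp_ofReal_mul_I_im]

/-- `(toCircle 1)^k = e^{2πik/L}` as a point of `U(1)`. [cite: FisherBarberJasnow1973, §II (twist by k flux quanta)] -/
theorem toCircle_one_zpow (k : ℤ) :
    (ZMod.toCircle (1 : ZMod L) ^ k : Circle) = Circle.exp (2 * π * k / L) := by
  apply Subtype.ext
  rw [Circle.coe_zpow, Circle.coe_exp]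
  have h1 : ((ZMod.toCircle (1 : ZMod L) : Circle) : ℂ) = Complex.exp (2 * π * Complex.I / L) := by
    have := ZMod.toCircle_natCast (N := L) 1
    simp only [Nat.cast_one, mul_one] at this
    exact this
  rw [h1, ← Complex.exp_int_mul]
  congr 1
  push_cast
  ring

/-- **Bond characters under the gauge transformation** `θ ↦ θ·g`:
`χ_{(z,i)}(θ g) = χ_{(z,i)}(θ) · e^{2πik·s_{(z,i)}/L}` with `s` the twist profile along `e₁`
(`1` on `e₁`-bonds, `0` on `e₂`-bonds). [cite: FisherBarberJasnow1973, §II eqs. (2.3)–(2.5)] -/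
theorem torusXY_bondChar_mul_torusGauge (k : ℤ) (θ : TorusSite 2 L → Circle) (b : TorusSite 2 L × Fin 2) :
    (torusXY 2 L).bondChar b (θ * fun z => ZMod.toCircle (z 0) ^ k) =
      (torusXY 2 L).bondChar b θ * Circle.exp (2 * π * k / L * torusTwistProfile L b) := by
  obtain ⟨z, i⟩ := b
  change (θ z * ZMod.toCircle (z 0) ^ k)⁻¹ *
      (θ (z + Pi.single i 1) * ZMod.toCircle ((z + Pi.single i 1 : TorusSite 2 L) 0) ^ k) =
    (θ z)⁻¹ * θ (z + Pi.single i 1) * Circle.exp (2 * π * k / L * torusTwistProfile L (z, i))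
  rw [mul_inv, mul_mul_mul_comm, torusGauge_bond]
  congr 1
  unfold torusTwistProfile
  split_ifs with hi
  · rw [mul_one, toCircle_one_zpow]
  · rw [mul_zero, Circle.exp_zero]

/-- **Gauge covariance of the twisted Hamiltonian**: `H_t(θ·g) = H_{t + 2πk/L}(θ)` for the gauge function of
`k` flux quanta. [cite: FisherBarberJasnow1973, §II eqs. (2.3)–(2.5) (a twist L·t of the boundary condition is gauge-equivalent to the uniform gradient t)] -/
theorem torusXY_twistHamiltonian_mul_torusGauge (K t : ℝ) (k : ℤ) (θ : TorusSite 2 L → Circle) :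
    (torusXY 2 L).twistHamiltonian (fun _ => K) (torusTwistProfile L) t
        (θ * fun z => ZMod.toCircle (z 0) ^ k) =
      (torusXY 2 L).twistHamiltonian (fun _ => K) (torusTwistProfile L) (t + 2 * π * k / L) θ := by
  unfold BondSystem.twistHamiltonian
  refine Finset.sum_congr rfl fun b _ => ?_
  congr 1
  rw [cos_mul_reChar_sub_sin_mul_imChar, cos_mul_reChar_sub_sin_mul_imChar,
    torusXY_bondChar_mul_torusGauge, mul_left_comm, ← Circle.exp_add,
    mul_comm (((torusXY 2 L).bondChar b) θ), ← add_mul]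

variable [MeasurableSpace Circle] [BorelSpace Circle]

/-- **Flux periodicity of the twisted torus**: `Z_L(t + 2πk/L) = Z_L(t)` for every `k ∈ ℤ` — a twist by a
whole number of flux quanta around the `e₁`-cycle is removed by the gauge transformation
`θ_z ↦ θ_z e^{2πikz₁/L}`, under which the Haar measure is invariant. [cite: FisherBarberJasnow1973, §II eqs. (2.3)–(2.5) (twisted boundary conditions defined modulo 2π)] -/
theorem torusXY_twistPartitionFn_add_fluxQuantum (K t : ℝ) (k : ℤ) :
    (torusXY 2 L).twistPartitionFn (fun _ => K) (torusTwistProfile L) (t + 2 * π * k / L) =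
      (torusXY 2 L).twistPartitionFn (fun _ => K) (torusTwistProfile L) t := by
  rw [BondSystem.twistPartitionFn, BondSystem.twistPartitionFn,
    ← integral_torusHaar_mul_right (fun θ => (torusXY 2 L).twistWeight (fun _ => K)
      (torusTwistProfile L) t θ) (fun z : TorusSite 2 L => ZMod.toCircle (z 0) ^ k)]
  refine integral_congr_ae (ae_of_all _ fun θ => ?_)
  simp only [BondSystem.twistWeight, torusXY_twistHamiltonian_mul_torusGauge]

/-- In particular `Z_L(2πk/L) = Z_L(0)`: a total twist of `k` flux quanta costs nothing. [cite: FisherBarberJasnow1973, §II eqs. (2.3)–(2.5)] -/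
theorem torusXY_twistPartitionFn_fluxQuantum (K : ℝ) (k : ℤ) :
    (torusXY 2 L).twistPartitionFn (fun _ => K) (torusTwistProfile L) (2 * π * k / L) =
      (torusXY 2 L).twistPartitionFn (fun _ => K) (torusTwistProfile L) 0 := by
  have h := torusXY_twistPartitionFn_add_fluxQuantum (L := L) K 0 k
  rwa [zero_add] at h

omit [MeasurableSpace Circle] [BorelSpace Circle] in
/-- Every twist is within half a flux quantum of a gauge copy: for every `t` there is `k ∈ ℤ` with
`|t + 2πk/L| ≤ π/L`. [cite: FisherBarberJasnow1973, §II (twists modulo 2π)] -/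
theorem exists_fluxQuantum_reduction (t : ℝ) :
    ∃ k : ℤ, |t + 2 * π * k / L| ≤ π / L := by
  have hL : (0 : ℝ) < L := Nat.cast_pos.2 (Nat.pos_of_ne_zero (NeZero.ne L))
  refine ⟨-round (t * L / (2 * π)), ?_⟩
  have hr := abs_sub_round (t * L / (2 * π))
  have hkey : t + 2 * π * ((-round (t * L / (2 * π)) : ℤ) : ℝ) / L =
      (2 * π / L) * (t * L / (2 * π) - round (t * L / (2 * π))) := by
    push_cast
    field_simp
    ring
  rw [hkey, abs_mul, abs_of_pos (by positivity : (0 : ℝ) < 2 * π / L)]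
  calc 2 * π / L * |t * L / (2 * π) - round (t * L / (2 * π))| ≤ 2 * π / L * (1 / 2) :=
        mul_le_mul_of_nonneg_left hr (by positivity)
    _ = π / L := by ring

end Gauge

/-! ## §2 The uniform Bloch-wall bound -/

section Uniform

variable {L : ℕ} [NeZero L] [MeasurableSpace Circle] [BorelSpace Circle]

/-- The spin-wave parabola of the sibling file read with the torus bond energy: for `K ≥ 0` and every `t`,
`log Z_L(0) − log Z_L(t) ≤ L²·(Kt²/2)·E_L(K)` (all `2L²` bond energies equal `E_L(K)`, one `e₁`-bond per
site). [cite: FrohlichPfister1983, Lemma 3.1 p. 308 (eq. (3.4))] -/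
theorem torusXY_log_twist_le_sq_energy {K : ℝ} (hK : 0 ≤ K) (t : ℝ) (b₀ : TorusSite 2 L × Fin 2) :
    Real.log ((torusXY 2 L).twistPartitionFn (fun _ => K) (torusTwistProfile L) 0) -
        Real.log ((torusXY 2 L).twistPartitionFn (fun _ => K) (torusTwistProfile L) t) ≤
      (L : ℝ) ^ 2 * (K * t ^ 2 / 2 * torusXYBondEnergy L K b₀) := by
  obtain ⟨-, h1⟩ := (torusXY 2 L).log_twistPartitionFn_zero_sub_mem_Icc (J := fun _ => K)
    (fun _ => hK) (torusTwistProfile L) t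
  refine h1.trans (le_of_eq ?_)
  have hE : ∀ b, (torusXY 2 L).expectJ (fun _ => K) (reChar ((torusXY 2 L).bondChar b)) =
      torusXYBondEnergy L K b₀ := fun b => by
    rw [torusXY_expectJ_reChar_bondChar, torusXYBondEnergy_eq K b b₀]
  simp_rw [hE]
  have hs : ∑ b : TorusSite 2 L × Fin 2, K * torusTwistProfile L b ^ 2 * torusXYBondEnergy L K b₀ =
      K * torusXYBondEnergy L K b₀ * ∑ b : TorusSite 2 L × Fin 2, torusTwistProfile L b ^ 2 := by
    rw [Finset.mul_sum]
    exact Finset.sum_congr rfl fun b _ => by ring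
  rw [hs, sum_torusTwistProfile_sq_eq_card, Fintype.card_pi, prod_const, ZMod.card, card_univ,
    Fintype.card_fin]
  push_cast
  ring

/-- **The uniform Bloch-wall bound.** For the plane rotator on `(ℤ/Lℤ)²` at coupling `K ≥ 0` and EVERY twist
`t` per `e₁`-bond: `log Z_L(0) − log Z_L(t) ≤ (π²/2)·K·E_L(K)` — uniformly in the volume and in the twist
(flux periodicity reduces `t` to `|t'| ≤ π/L`, where `L²·(Kt'²/2)·E_L ≤ π²KE_L/2`). The free energy of a
Bloch wall of any angle across the two-dimensional torus is bounded: zero wall tension at every temperature,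
with an explicit constant. [cite: FrohlichPfister1983, Lemma 3.1 p. 307–308 (τ = 0 for the XY model in any dimension: 0 ≤ −π(L,T) ≤ O(L^{d−2} log L))] -/
theorem torusXY_log_twist_le_uniform {K : ℝ} (hK : 0 ≤ K) (t : ℝ) (b₀ : TorusSite 2 L × Fin 2) :
    Real.log ((torusXY 2 L).twistPartitionFn (fun _ => K) (torusTwistProfile L) 0) -
        Real.log ((torusXY 2 L).twistPartitionFn (fun _ => K) (torusTwistProfile L) t) ≤
      π ^ 2 / 2 * K * torusXYBondEnergy L K b₀ := by
  have hL : (0 : ℝ) < L := Nat.cast_pos.2 (Nat.pos_of_ne_zero (NeZero.ne L))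
  obtain ⟨k, hk⟩ := exists_fluxQuantum_reduction (L := L) t
  rw [← torusXY_twistPartitionFn_add_fluxQuantum K t k]
  refine (torusXY_log_twist_le_sq_energy hK _ b₀).trans ?_
  have hE : 0 ≤ torusXYBondEnergy L K b₀ :=
    (torusXY 2 L).expectJ_reChar_nonneg (J := fun _ => K) (fun _ => hK) _
  have hsq : (t + 2 * π * k / L) ^ 2 ≤ (π / L) ^ 2 := by
    have := sq_le_sq' (abs_le.1 hk).1 (abs_le.1 hk).2
    simpa using this
  have h1 : (L : ℝ) ^ 2 * (K * (t + 2 * π * k / L) ^ 2 / 2 * torusXYBondEnergy L K b₀) ≤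
      (L : ℝ) ^ 2 * (K * (π / L) ^ 2 / 2 * torusXYBondEnergy L K b₀) := by
    refine mul_le_mul_of_nonneg_left (mul_le_mul_of_nonneg_right ?_ hE) (by positivity)
    exact div_le_div_of_nonneg_right (mul_le_mul_of_nonneg_left hsq hK) (by norm_num)
  refine h1.trans (le_of_eq ?_)
  field_simp

/-- Per site: `(log Z_L(0) − log Z_L(t))/L² ≤ (π²/2)·K·E_L(K)/L²` — the twist free energy per site is
`O(L⁻²)` uniformly in the twist. [cite: FrohlichPfister1983, Lemma 3.1 p. 307–308] -/
theorem torusXY_log_twist_div_card_le_uniform {K : ℝ} (hK : 0 ≤ K) (t : ℝ) (b₀ : TorusSite 2 L × Fin 2) :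
    (Real.log ((torusXY 2 L).twistPartitionFn (fun _ => K) (torusTwistProfile L) 0) -
        Real.log ((torusXY 2 L).twistPartitionFn (fun _ => K) (torusTwistProfile L) t)) /
      (Fintype.card (TorusSite 2 L) : ℝ) ≤ π ^ 2 / 2 * K * torusXYBondEnergy L K b₀ / (L : ℝ) ^ 2 := by
  have hcard : (Fintype.card (TorusSite 2 L) : ℝ) = (L : ℝ) ^ 2 := by
    rw [Fintype.card_pi, prod_const, ZMod.card, card_univ, Fintype.card_fin]
    push_cast
    ring
  have hL : (0 : ℝ) < (L : ℝ) ^ 2 := by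
    have : (0 : ℝ) < L := Nat.cast_pos.2 (Nat.pos_of_ne_zero (NeZero.ne L))
    positivity
  rw [hcard]
  exact div_le_div_of_nonneg_right (torusXY_log_twist_le_uniform hK t b₀) hL.le

/-- With the equipartition energy ceiling `E_L(K) ≤ 8K/(1 + 8K)`: **`log Z_L(0) − log Z_L(t) ≤ 4π²K²/(1 + 8K)`**
for every `L ≥ 3`, `K > 0` and every twist `t`. [cite: FrohlichPfister1983, Lemma 3.1 p. 307–308; AizenmanSimon1980LocalWard eq. (2.4) (energy input via the tree)] -/
theorem torusXY_log_twist_le_uniform_energyCeiling (hL : 3 ≤ L) {K : ℝ} (hK : 0 < K) (t : ℝ) :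
    Real.log ((torusXY 2 L).twistPartitionFn (fun _ => K) (torusTwistProfile L) 0) -
        Real.log ((torusXY 2 L).twistPartitionFn (fun _ => K) (torusTwistProfile L) t) ≤
      4 * π ^ 2 * K ^ 2 / (1 + 8 * K) := by
  refine (torusXY_log_twist_le_uniform hK.le t (0, 0)).trans ?_
  have h := torusXYBondEnergy_le hL hK (0, 0)
  have h2 : π ^ 2 / 2 * K * torusXYBondEnergy L K (0, 0) ≤ π ^ 2 / 2 * K * (8 * K / (1 + 8 * K)) :=
    mul_le_mul_of_nonneg_left h (by positivity)
  refine h2.trans (le_of_eq ?_)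
  field_simp
  ring

end Uniform

end Literature.Probability.LatticeModels
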